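import Mathlib
import Summits.PneNP.PneNP.Theorems.OverlapGapAlgebraSolvableImpliesStableSectionPeelingMoments

/-!
# PneNP / OverlapGapAlgebra — crux `SolvableImpliesStableSection` (stmt-PneNP-2463):
# the PEELING block (4/5) — the mean number of surviving clauses

Support for crux `stmt-PneNP-2463` (`Summit.PneNP.PneNP.Theses.OverlapGapAlgebra.SolvableImpliesStableSection`):
the f-free block "bounded-round private-variable peeling gives stable sections for `k α < 1`".

* `sissP_core_mean` — the arithmetic of the first moment, abstractly: an indicator dominated by
  `A + ∑_{L<R} B_L` with `(∑ A)·n^R ≤ m^R k^R N` and `(∑ B_L)·n^{L+1} ≤ m^L k^L L k N` has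
  `∑ ≤ N((m k/n)^R + R² k/n)` once `m k ≤ n`;
* `sissP_sum_card_alive_le` — THE MEAN BOUND: for any family `alive` obeying the forward peeling rule
  (a clause alive at round `t+1` has, for each slot, another clause alive at round `t` containing that
  slot's variable), `∑_Φ #{i : alive R Φ i} ≤ m · #Inst · ((m k / n)^R + R² k / n)` (`m k ≤ n`,
  `k ≥ 2` through a fixed-point-free slot map `dn`).  For the `R`-round private-variable peeling of
  `F_k(n, ⌊α n⌋)`: on average at most `((kα)^R + R² k/n)·m` clauses survive `R` rounds — the bound on
  the mean violation of the peeling section (`sissP_indicator_le`, `sissP_sum_card_injW_mul_le`,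
  `sissP_sum_card_colW_mul_le`).
No definitions; axioms `propext`, `Classical.choice`, `Quot.sound`.
-/

set_option linter.dupNamespace false -- `Summit.PneNP.PneNP.…`: summit = sub-problem (D-0017)

namespace Summit.PneNP.PneNP.Theorems

open Finset
open scoped Classical

section PeelMean

variable {m k n : ℕ}

/-- **The arithmetic of the first moment.** If an indicator `ind` is dominated pointwise by
`A + ∑_{L<R} B_L` (naturals), `(∑_Φ A Φ)·n^R ≤ m^R k^R·N`, `(∑_Φ B_L Φ)·n^{L+1} ≤ m^L k^L·L·k·N` for
all `L`, `1 ≤ n` and `m k ≤ n`, then `∑_Φ [ind Φ] ≤ N·((m k/n)^R + R² k/n)`. -/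
theorem sissP_core_mean {ι : Type*} [Fintype ι] (ind : ι → Prop) (A : ι → ℕ) (B : ℕ → ι → ℕ)
    (R N : ℕ) (hn : 1 ≤ n) (hmk : m * k ≤ n)
    (hpt : ∀ x, ind x → 1 ≤ A x + ∑ L ∈ Finset.range R, B L x)
    (hA : (∑ x, A x) * n ^ R ≤ m ^ R * k ^ R * N)
    (hB : ∀ L, (∑ x, B L x) * n ^ (L + 1) ≤ m ^ L * k ^ L * L * k * N) :
    (∑ x, (if ind x then (1 : ℝ) else 0))
      ≤ N * ((((m * k : ℕ) : ℝ) / n) ^ R + (R : ℝ) ^ 2 * k / n) := by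
  have hnR : (1 : ℝ) ≤ n := by exact_mod_cast hn
  have hnpos : (0 : ℝ) < n := by linarith
  have hρ : ((m * k : ℕ) : ℝ) / n ≤ 1 := by
    rw [div_le_one hnpos]; exact_mod_cast hmk
  have hρ0 : 0 ≤ ((m * k : ℕ) : ℝ) / n := by positivity
  have hN0 : (0 : ℝ) ≤ N := Nat.cast_nonneg _
  have hk0 : (0 : ℝ) ≤ k := Nat.cast_nonneg _
  -- pointwise, in `ℝ`
  have hpt' : ∀ x, (if ind x then (1 : ℝ) else 0) ≤ (A x : ℝ) + ∑ L ∈ Finset.range R, (B L x : ℝ) := by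
    intro x
    split_ifs with hx
    · have h := hpt x hx
      have h' : ((1 : ℕ) : ℝ) ≤ ((A x + ∑ L ∈ Finset.range R, B L x : ℕ) : ℝ) := by exact_mod_cast h
      push_cast at h'
      exact h'
    · positivity
  -- the two sums, in `ℝ`
  have hAR : (∑ x, (A x : ℝ)) ≤ N * (((m * k : ℕ) : ℝ) / n) ^ R := by
    have h1 : (∑ x, (A x : ℝ)) * (n : ℝ) ^ R ≤ (m : ℝ) ^ R * (k : ℝ) ^ R * N := by
      have := hA; rw [← Nat.cast_sum]; exact_mod_cast this
    have hnR' : (0 : ℝ) < (n : ℝ) ^ R := by positivity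
    rw [← le_div_iff₀ hnR'] at h1
    refine h1.trans (le_of_eq ?_)
    rw [div_pow]; push_cast; ring
  have hBR : ∀ L, L < R → (∑ x, (B L x : ℝ)) ≤ N * ((R : ℝ) * k / n) := by
    intro L hL
    have h1 : (∑ x, (B L x : ℝ)) * (n : ℝ) ^ (L + 1) ≤ (m : ℝ) ^ L * (k : ℝ) ^ L * L * k * N := by
      have := hB L; rw [← Nat.cast_sum]; exact_mod_cast this
    have hnL : (0 : ℝ) < (n : ℝ) ^ (L + 1) := by positivity
    rw [← le_div_iff₀ hnL] at h1
    refine h1.trans ?_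
    have hLR : (L : ℝ) ≤ R := by exact_mod_cast hL.le
    have hρL : ((m : ℝ) * k / n) ^ L ≤ 1 := by
      have : ((m : ℝ) * k / n) = ((m * k : ℕ) : ℝ) / n := by push_cast; ring
      rw [this]; exact pow_le_one₀ hρ0 hρ
    calc (m : ℝ) ^ L * (k : ℝ) ^ L * L * k * N / (n : ℝ) ^ (L + 1)
        = ((m : ℝ) * k / n) ^ L * (L * k / n) * N := by
          rw [div_pow, mul_pow, pow_succ, div_mul_div_comm, div_mul_eq_mul_div]; ring
      _ ≤ 1 * (R * k / n) * N := by
          apply mul_le_mul_of_nonneg_right _ hN0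
          apply mul_le_mul hρL _ (by positivity) zero_le_one
          exact div_le_div_of_nonneg_right (mul_le_mul_of_nonneg_right hLR hk0) hnpos.le
      _ = N * ((R : ℝ) * k / n) := by ring
  calc (∑ x, (if ind x then (1 : ℝ) else 0))
      ≤ ∑ x, ((A x : ℝ) + ∑ L ∈ Finset.range R, (B L x : ℝ)) := Finset.sum_le_sum fun x _ => hpt' x
    _ = (∑ x, (A x : ℝ)) + ∑ L ∈ Finset.range R, ∑ x, (B L x : ℝ) := by
        rw [Finset.sum_add_distrib, Finset.sum_comm]
    _ ≤ N * (((m * k : ℕ) : ℝ) / n) ^ R + ∑ L ∈ Finset.range R, N * ((R : ℝ) * k / n) :=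
        add_le_add hAR (Finset.sum_le_sum fun L hL => hBR L (Finset.mem_range.1 hL))
    _ = N * ((((m * k : ℕ) : ℝ) / n) ^ R + (R : ℝ) ^ 2 * k / n) := by
        rw [Finset.sum_const, Finset.card_range, nsmul_eq_mul]; ring

/-- **The mean number of surviving clauses.** Let `alive : ℕ → instances → clauses → Prop` obey the
forward peeling rule (`hsucc`: a clause alive at round `t+1` has, for each slot, ANOTHER clause alive at
round `t` containing that slot's variable), let `j₀ : Fin k`, `dn v ≠ v` (so `k ≥ 2`), `1 ≤ n` and
`m k ≤ n`. Then `∑_Φ #{i : alive R Φ i} ≤ m · #Inst · ((m k / n)^R + R² k / n)`. -/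
theorem sissP_sum_card_alive_le (alive : ℕ → (Fin m → Fin k → Fin n × Bool) → Fin m → Prop)
    (hsucc : ∀ (Φ : Fin m → Fin k → Fin n × Bool) (t : ℕ) (i : Fin m), alive (t + 1) Φ i →
      ∀ j : Fin k, ∃ i' : Fin m, alive t Φ i' ∧ i' ≠ i ∧ ∃ j' : Fin k, (Φ i' j').1 = (Φ i j).1)
    (dn : Fin k → Fin k) (hdn : ∀ v, dn v ≠ v) (j₀ : Fin k) (R : ℕ) (hn : 1 ≤ n) (hmk : m * k ≤ n) :
    (∑ Φ : Fin m → Fin k → Fin n × Bool,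
        (((univ : Finset (Fin m)).filter fun i => alive R Φ i).card : ℝ))
      ≤ m * Fintype.card (Fin m → Fin k → Fin n × Bool) *
          ((((m * k : ℕ) : ℝ) / n) ^ R + (R : ℝ) ^ 2 * k / n) := by
  set N : ℕ := Fintype.card (Fin m → Fin k → Fin n × Bool) with hN
  -- pointwise in `i`
  have hi : ∀ i : Fin m, (∑ Φ : Fin m → Fin k → Fin n × Bool, (if alive R Φ i then (1 : ℝ) else 0))
      ≤ N * ((((m * k : ℕ) : ℝ) / n) ^ R + (R : ℝ) ^ 2 * k / n) := by
    intro i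
    refine sissP_core_mean (fun Φ : Fin m → Fin k → Fin n × Bool => alive R Φ i)
      (fun Φ : Fin m → Fin k → Fin n × Bool => ((univ : Finset ((Fin R → Fin m) × (Fin R → Fin k))).filter fun p =>
          (∀ a b, a ≤ R → b ≤ R →
            (fun e : ℕ => if h : 0 < e ∧ e ≤ R then p.1 ⟨e - 1, Nat.sub_one_lt_of_le h.1 h.2⟩ else i) a =
            (fun e : ℕ => if h : 0 < e ∧ e ≤ R then p.1 ⟨e - 1, Nat.sub_one_lt_of_le h.1 h.2⟩ else i) b → a = b) ∧
          ∀ d, d < R →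
            (Φ ((fun e : ℕ => if h : 0 < e ∧ e ≤ R then p.1 ⟨e - 1, Nat.sub_one_lt_of_le h.1 h.2⟩ else i) (d + 1))
                ((fun e : ℕ => if h : 0 < e ∧ e ≤ R then p.2 ⟨e - 1, Nat.sub_one_lt_of_le h.1 h.2⟩
                    else j₀) (d + 1))).1 =
            (Φ ((fun e : ℕ => if h : 0 < e ∧ e ≤ R then p.1 ⟨e - 1, Nat.sub_one_lt_of_le h.1 h.2⟩ else i) d)
                (dn ((fun e : ℕ => if h : 0 < e ∧ e ≤ R then p.2 ⟨e - 1, Nat.sub_one_lt_of_le h.1 h.2⟩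
                    else j₀) d))).1).card)
      (fun (L : ℕ) (Φ : Fin m → Fin k → Fin n × Bool) => ((univ : Finset ((Fin L → Fin m) × (Fin L → Fin k) × Fin L × Fin k)).filter fun p =>
          (∀ a b, a ≤ L → b ≤ L →
            (fun e : ℕ => if h : 0 < e ∧ e ≤ L then p.1 ⟨e - 1, Nat.sub_one_lt_of_le h.1 h.2⟩ else i) a =
            (fun e : ℕ => if h : 0 < e ∧ e ≤ L then p.1 ⟨e - 1, Nat.sub_one_lt_of_le h.1 h.2⟩ else i) b → a = b) ∧
          (∀ d, d < L →
            (Φ ((fun e : ℕ => if h : 0 < e ∧ e ≤ L then p.1 ⟨e - 1, Nat.sub_one_lt_of_le h.1 h.2⟩ else i) (d + 1))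
                ((fun e : ℕ => if h : 0 < e ∧ e ≤ L then p.2.1 ⟨e - 1, Nat.sub_one_lt_of_le h.1 h.2⟩
                    else j₀) (d + 1))).1 =
            (Φ ((fun e : ℕ => if h : 0 < e ∧ e ≤ L then p.1 ⟨e - 1, Nat.sub_one_lt_of_le h.1 h.2⟩ else i) d)
                (dn ((fun e : ℕ => if h : 0 < e ∧ e ≤ L then p.2.1 ⟨e - 1, Nat.sub_one_lt_of_le h.1 h.2⟩
                    else j₀) d))).1) ∧
          (Φ ((fun e : ℕ => if h : 0 < e ∧ e ≤ L then p.1 ⟨e - 1, Nat.sub_one_lt_of_le h.1 h.2⟩ else i) L)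
              (dn ((fun e : ℕ => if h : 0 < e ∧ e ≤ L then p.2.1 ⟨e - 1, Nat.sub_one_lt_of_le h.1 h.2⟩
                  else j₀) L))).1 =
          (Φ ((fun e : ℕ => if h : 0 < e ∧ e ≤ L then p.1 ⟨e - 1, Nat.sub_one_lt_of_le h.1 h.2⟩ else i) p.2.2.1)
              p.2.2.2).1).card)
      R N hn hmk ?_ ?_ ?_
    · intro Φ hal
      exact sissP_indicator_le alive Φ (hsucc Φ) dn R i j₀ hal
    · exact sissP_sum_card_injW_mul_le dn R i j₀
    · intro L
      exact sissP_sum_card_colW_mul_le dn hdn L i j₀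
  -- sum over `i`
  have hcard : ∀ Φ : Fin m → Fin k → Fin n × Bool,
      ((((univ : Finset (Fin m)).filter fun i => alive R Φ i).card : ℕ) : ℝ)
        = ∑ i : Fin m, (if alive R Φ i then (1 : ℝ) else 0) := by
    intro Φ
    rw [Finset.card_filter]
    push_cast
    rfl
  calc (∑ Φ : Fin m → Fin k → Fin n × Bool,
        (((univ : Finset (Fin m)).filter fun i => alive R Φ i).card : ℝ))
      = ∑ Φ : Fin m → Fin k → Fin n × Bool, ∑ i : Fin m, (if alive R Φ i then (1 : ℝ) else 0) :=
        Finset.sum_congr rfl fun Φ _ => hcard Φ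
    _ = ∑ i : Fin m, ∑ Φ : Fin m → Fin k → Fin n × Bool, (if alive R Φ i then (1 : ℝ) else 0) :=
        Finset.sum_comm
    _ ≤ ∑ _i : Fin m, (N : ℝ) * ((((m * k : ℕ) : ℝ) / n) ^ R + (R : ℝ) ^ 2 * k / n) :=
        Finset.sum_le_sum fun i _ => hi i
    _ = m * N * ((((m * k : ℕ) : ℝ) / n) ^ R + (R : ℝ) ^ 2 * k / n) := by
        rw [Finset.sum_const, Finset.card_univ, Fintype.card_fin, nsmul_eq_mul]; ring

end PeelMean

end Summit.PneNP.PneNP.Theorems
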